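import Summits.CriticalPhenomena.PercolationContinuityZ3.Theorems.Transplant.Slab111VHelix
import HarnessLib

/-!
# Paths in the `(111)`-films `F_k`, III: the COMPUTABLE MODEL — vertex data `((a, b), ℓ)`, decidable steps, and soundness (`GPath` from checked data)

builds on p205010 (kernel theorem, internal audit signed; external expert review pending) — NOT used in this file.  Lane `prim-bschramm`, seat
`prim-bschramm-p2` (gen 34; class C1b; memo `HOME/bschramm/P2-LATTICES.md` §128(3c)); helper file (`--supports stmt-CriticalPhenomena-4575 --as helper`).
The routing template for `ShapedLinkage 3 (Slab111.hexShadow k)` is certified by KERNEL COMPUTATION on plain data («TriClawTable» pattern): a piece of a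
routing is a list of model vertices `((a, b), ℓ) : (ℤ × ℤ) × ℤ` (shadow column `(a, b)`, level `ℓ`); that consecutive entries are film edges, that the list is
duplicate-free, that it avoids given columns/vertices — all DECIDABLE.  This file is the bridge to the film: `Slab111.MV`, `toV k : MV → slab111 k`
(`= vl k ![a, b] ℓ`), the step relation `MStep` (one of the three up-directions, either way; an `abbrev`, so decidable by unfolding),
**`gpath_of_mchain`** (an `MStep`-chain of admissible, duplicate-free data is a `GPath` of the film), and the read-back lemmas `sh_toV`, `lev_toV`, `toV_inj`.
[cite: DuminilCopinSidoraviciusTassion2016, §2.3 (proof of Fact 2: the paths γ_u, γ_v, γ_w)]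
-/

noncomputable section

namespace Summit.CriticalPhenomena.PercolationContinuityZ3.Theorems.Transplant

open Literature.Probability.Percolation Literature.Probability.LatticeModels SimpleGraph
open scoped Classical

namespace Slab111

variable {k : ℕ}

/-- Model vertices: (shadow column as an integer pair, level). [folklore] -/
abbrev MV := (ℤ × ℤ) × ℤ

/-- The shadow column of a model vertex as a `Site 2`. [folklore] -/
def mcol (p : MV) : Site 2 := ![p.1.1, p.1.2]

/-- Coordinates of `mcol`. [folklore] -/
@[simp] theorem mcol_zero (p : MV) : mcol p 0 = p.1.1 := rfl
/-- Coordinates of `mcol`. [folklore] -/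
@[simp] theorem mcol_one (p : MV) : mcol p 1 = p.1.2 := rfl

/-- **The film vertex of a model vertex.** [folklore] -/
def toV (k : ℕ) (p : MV) : slab111 k := vl k (mcol p) p.2

/-- Admissibility of a model vertex (right residue, level in `[0, k]`), in coordinates. [folklore] -/
abbrev MAdm (k : ℕ) (p : MV) : Prop := (3 : ℤ) ∣ p.2 - (p.1.1 + 2 * p.1.2) ∧ 0 ≤ p.2 ∧ p.2 ≤ k

/-- `MAdm` is `Adm` of the column. [folklore] -/
theorem adm_of_madm {p : MV} (h : MAdm k p) : Adm k (mcol p) p.2 := by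
  obtain ⟨h1, h2, h3⟩ := h
  exact ⟨by simpa [lvl] using h1, h2, h3⟩

/-- The shadow of `toV`. [folklore] -/
@[simp] theorem sh_toV {p : MV} (h : MAdm k p) : sh (toV k p) = mcol p := sh_vl (adm_of_madm h)

/-- The level of `toV`. [folklore] -/
@[simp] theorem lev_toV {p : MV} (h : MAdm k p) : lev ((toV k p : slab111 k) : Site 3) = p.2 := lev_vl (adm_of_madm h)

/-- `toV` is injective on admissible data. [folklore] -/
theorem toV_inj {p p' : MV} (h : MAdm k p) (h' : MAdm k p') (heq : toV k p = toV k p') : p = p' := by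
  have := (vl_inj (adm_of_madm h) (adm_of_madm h')).1 heq
  obtain ⟨hc, hl⟩ := this
  have h0 := congrFun hc 0; have h1 := congrFun hc 1
  simp only [mcol_zero, mcol_one] at h0 h1
  ext <;> simp [*]

/-- **One model step**: the columns differ by an up-direction and the level by `+1`, either way round (in coordinates:
`(Δa, Δb) ∈ {(1,0), (0,−1), (−1,1)}` with `Δℓ = +1`, or the negatives). [folklore] -/
abbrev MStep (p p' : MV) : Prop :=
  (p'.2 = p.2 + 1 ∧ ((p'.1.1 = p.1.1 + 1 ∧ p'.1.2 = p.1.2) ∨ (p'.1.1 = p.1.1 ∧ p'.1.2 = p.1.2 - 1) ∨ (p'.1.1 = p.1.1 - 1 ∧ p'.1.2 = p.1.2 + 1))) ∨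
  (p.2 = p'.2 + 1 ∧ ((p.1.1 = p'.1.1 + 1 ∧ p.1.2 = p'.1.2) ∨ (p.1.1 = p'.1.1 ∧ p.1.2 = p'.1.2 - 1) ∨ (p.1.1 = p'.1.1 - 1 ∧ p.1.2 = p'.1.2 + 1)))

/-- An up-step in coordinates is an up-step by `u₁`, `u₂` or `u₃`. [folklore] -/
theorem adj_toV_of_up {p p' : MV} (h : MAdm k p) (h' : MAdm k p') (hl : p'.2 = p.2 + 1)
    (hc : (p'.1.1 = p.1.1 + 1 ∧ p'.1.2 = p.1.2) ∨ (p'.1.1 = p.1.1 ∧ p'.1.2 = p.1.2 - 1) ∨ (p'.1.1 = p.1.1 - 1 ∧ p'.1.2 = p.1.2 + 1)) :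
    (film k).Adj (toV k p) (toV k p') := by
  have ha := adm_of_madm h; have ha' := adm_of_madm h'
  unfold toV
  rcases hc with ⟨h1, h2⟩ | ⟨h1, h2⟩ | ⟨h1, h2⟩
  · have hq : mcol p' = mcol p + u₁ := by ext i; fin_cases i <;> simp [h1, h2]
    rw [hq, hl] at ha' ⊢; exact adj_vl_u₁ ha ha'
  · have hq : mcol p' = mcol p + u₂ := by
      ext i; fin_cases i
      · simp [h1]
      · simp [h2]; ring
    rw [hq, hl] at ha' ⊢; exact adj_vl_u₂ ha ha'
  · have hq : mcol p' = mcol p + u₃ := by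
      ext i; fin_cases i
      · simp [h1]; ring
      · simp [h2]
    rw [hq, hl] at ha' ⊢; exact adj_vl_u₃ ha ha'

/-- **A model step between admissible vertices is a film edge.** [folklore] -/
theorem adj_toV_of_mstep {p p' : MV} (h : MAdm k p) (h' : MAdm k p') (hs : MStep p p') : (film k).Adj (toV k p) (toV k p') := by
  rcases hs with ⟨hl, hc⟩ | ⟨hl, hc⟩
  · exact adj_toV_of_up h h' hl hc
  · exact (adj_toV_of_up h' h hl hc).symm

/-- **SOUNDNESS OF THE MODEL**: a non-empty, duplicate-free `MStep`-chain of admissible model vertices maps to a self-avoiding path of the film.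
[cite: DuminilCopinSidoraviciusTassion2016, §2.3 (proof of Fact 2: the paths γ_u, γ_v, γ_w)] -/
theorem gpath_of_mchain {l : List MV} (hne : l ≠ []) (hadm : ∀ p ∈ l, MAdm k p) (hch : l.IsChain MStep) (hnd : l.Nodup) :
    GPath (film k) (l.map (toV k)) (toV k (l.head hne)) (toV k (l.getLast hne)) where
  ne_nil := by simpa using hne
  chain := by
    rw [List.isChain_map]
    exact hch.imp_of_mem_imp fun a b ha hb hab => adj_toV_of_mstep (hadm a ha) (hadm b hb) hab
  nodup := List.Nodup.map_on (fun a ha b hb hab => toV_inj (hadm a ha) (hadm b hb) hab) hnd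
  head := by rw [List.head?_map, List.head?_eq_some_head hne]; rfl
  last := by rw [List.getLast?_map, List.getLast?_eq_some_getLast hne]; rfl

/-- Membership read-back: a vertex of the mapped list is `toV` of a data entry. [folklore] -/
theorem mem_map_toV {l : List MV} {v : slab111 k} : v ∈ l.map (toV k) ↔ ∃ p ∈ l, toV k p = v := List.mem_map

/-- **Column avoidance read-back**: if no entry of `l` has column in `X` (data), no vertex of the mapped path has shadow in `mcol '' X`. [folklore] -/
theorem sh_not_mem_of_forall {l : List MV} (hadm : ∀ p ∈ l, MAdm k p) {bad : Set (Site 2)} (h : ∀ p ∈ l, mcol p ∉ bad) {v : slab111 k}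
    (hv : v ∈ l.map (toV k)) : sh v ∉ bad := by
  obtain ⟨p, hp, rfl⟩ := mem_map_toV.1 hv
  rw [sh_toV (hadm p hp)]; exact h p hp

end Slab111

end Summit.CriticalPhenomena.PercolationContinuityZ3.Theorems.Transplant

end
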